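import Literature.NumberTheory.LFunctions.EulerMaclaurinZeta
import Mathlib.NumberTheory.LSeries.DirichletContinuation
import HarnessLib

/-!
# A positive Dirichlet series with abscissa `1` vanishing on a full vertical progression on `Re s = 1/2`

Sharpness companion of `Literature.NumberTheory.LFunctions.LapidusVanFrankenhuijsen2006_thm11_12_absConv`
(no vertical arithmetic progression of zeros on lines in the closed half-plane of ABSOLUTE convergence of
a Dirichlet series with non-negative coefficients) and of the refutation of the printed
[LapidusVanfrankenhuijsen2006, Thm 11.12]: strictly LEFT of the abscissa nothing of the kind holds, even
with a single pole, polynomial growth in vertical strips and `0 < D < 1`.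

The witness (member `r = 2` of the family `∑_{m odd} m^{r-1} (m^r)^{-s} = (1 - 2^{r-1-rs}) ζ(rs-r+1)`):
`a_n = m` if `n = m²` with `m` odd, `a_n = 0` otherwise, so that for `Re s > 1`
`∑ a_n n^{-s} = ∑_{m odd} m^{1-2s} = L(2s-1, χ₀ mod 2) = (1 - 2^{1-2s}) ζ(2s-1) =: G(s)`.
`G` is holomorphic on `ℂ ∖ {1}`, meromorphic (simple pole) at `1`, satisfies
`‖G(s)‖ ≤ 375 (1 + |Im s|)³` on `0 ≤ Re s ≤ 2`, `|s - 1| ≥ 1`, and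
`G(1/2 + ikπ/log 2) = (1 - e^{-2πik}) ζ(2πik/log 2) = 0` for EVERY `k ∈ ℤ`.
In particular the route statement `Summit.Langlands.Langlands.Theses.DisagreementBeurling.NoVerticalAPZerosPos`
("add `0 < b`" repair of LvF Thm 11.12) fails at `θ = 0`, `b = 1/2`, `E = {1}`, `C = 375`, `κ = 3`,
`τ = π/log 2` (this file does not import the route; the refutation is the ten-line instantiation).
-/

noncomputable section

namespace Literature.NumberTheory.LFunctions

open Filter Complex Topology

/-- `‖ζ(w)‖ ≤ (|Im w| + 5)³` for `-1 ≤ Re w ≤ 3`, `‖w - 1‖ ≥ 1` (Euler–Maclaurin bound of the tree).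
[cite: Edwards1974, §6.4 eq. (1)] -/
theorem norm_riemannZeta_le_cube_of_re_mem_Icc {w : ℂ} (hw : -1 ≤ w.re) (hw' : w.re ≤ 3)
    (hw1 : 1 ≤ ‖w - 1‖) : ‖riemannZeta w‖ ≤ (|w.im| + 5) ^ 3 := by
  have hne : w ≠ 1 := by
    intro h; rw [h, sub_self, norm_zero] at hw1; norm_num at hw1
  have h := norm_riemannZeta_le_of_neg_one_le_re hw hne
  have hns : ‖w‖ ≤ |w.im| + 3 := by
    refine (norm_le_abs_re_add_abs_im w).trans ?_
    have : |w.re| ≤ 3 := abs_le.mpr ⟨by linarith, hw'⟩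
    linarith
  have hns1 : ‖w + 1‖ ≤ |w.im| + 4 := (norm_add_le _ _).trans (by simp; linarith)
  have hns2 : ‖w + 2‖ ≤ |w.im| + 5 := (norm_add_le _ _).trans (by
    rw [Complex.norm_ofNat]; linarith)
  have h1 : 1 / ‖w - 1‖ ≤ 1 := by rw [div_le_one (by linarith)]; exact hw1
  have h0 : 0 ≤ |w.im| := abs_nonneg _
  set u : ℝ := |w.im| + 5 with hu
  have hu5 : 5 ≤ u := by rw [hu]; linarith
  have h2 : ‖w‖ * ‖w + 1‖ * ‖w + 2‖ ≤ u ^ 3 := by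
    calc ‖w‖ * ‖w + 1‖ * ‖w + 2‖ ≤ (|w.im| + 3) * (|w.im| + 4) * (|w.im| + 5) := by gcongr
      _ ≤ u * u * u := by rw [hu]; gcongr <;> linarith
      _ = u ^ 3 := by ring
  have h3 : ‖w‖ ≤ u := by rw [hu]; linarith
  have hu3 : u ≤ u ^ 3 := by
    have hsq : (1 : ℝ) ≤ u * u := by nlinarith
    nlinarith [mul_le_mul_of_nonneg_left hsq (by linarith : (0 : ℝ) ≤ u)]
  nlinarith

/-- The coefficients of the trivial Dirichlet character mod `2`. [folklore] -/
private lemma trivCharTwo_natCast (m : ℕ) :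
    ((1 : DirichletCharacter ℂ 2) (m : ZMod 2)) = if Odd m then 1 else 0 := by
  by_cases hm : Odd m
  · have hu : IsUnit (m : ZMod 2) := (ZMod.isUnit_iff_coprime m 2).mpr (Nat.coprime_two_right.mpr hm)
    rw [MulChar.one_apply hu, if_pos hm]
  · have hu : ¬ IsUnit (m : ZMod 2) := fun h =>
      hm (Nat.coprime_two_right.mp ((ZMod.isUnit_iff_coprime m 2).mp h))
    rw [MulChar.map_nonunit _ hu, if_neg hm]

/-- `L(w, χ₀ mod 2) = (1 - 2^{-w}) ζ(w)` for `w ≠ 1`. [folklore] -/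
private lemma lfunctionTrivCharTwo_eq {w : ℂ} (hw : w ≠ 1) :
    DirichletCharacter.LFunctionTrivChar 2 w = (1 - (2 : ℂ) ^ (-w)) * riemannZeta w := by
  rw [DirichletCharacter.LFunctionTrivChar_eq_mul_riemannZeta hw, Nat.Prime.primeFactors Nat.prime_two,
    Finset.prod_singleton]
  norm_num

/-- `L(2πik/log 2, χ₀ mod 2) = 0` for every integer `k`. [folklore] -/
private lemma lfunctionTrivCharTwo_vanish (k : ℤ) :
    DirichletCharacter.LFunctionTrivChar 2 ((k : ℂ) * ((2 * Real.pi / Real.log 2 : ℝ) : ℂ) * I) = 0 := by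
  have hlog : Real.log 2 ≠ 0 := (Real.log_pos one_lt_two).ne'
  set w : ℂ := (k : ℂ) * ((2 * Real.pi / Real.log 2 : ℝ) : ℂ) * I with hw
  have hre : w.re = 0 := by
    simp only [hw, Complex.mul_re, Complex.I_re, Complex.I_im, Complex.mul_im, Complex.ofReal_im,
      Complex.ofReal_re, Complex.intCast_re, Complex.intCast_im]
    ring
  have hw1 : w ≠ 1 := by
    intro h
    have := congrArg Complex.re h
    rw [hre, Complex.one_re] at this
    norm_num at this
  rw [lfunctionTrivCharTwo_eq hw1]
  have h2 : (2 : ℂ) ^ (-w) = 1 := by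
    rw [Complex.cpow_def_of_ne_zero two_ne_zero,
      show Complex.log 2 = ((Real.log 2 : ℝ) : ℂ) by
        rw [show (2 : ℂ) = ((2 : ℝ) : ℂ) by norm_num, ← Complex.ofReal_log (by norm_num)]]
    have hlogC : ((Real.log 2 : ℝ) : ℂ) ≠ 0 := by exact_mod_cast hlog
    have : ((Real.log 2 : ℝ) : ℂ) * -w = ((-k : ℤ) : ℂ) * (2 * Real.pi * I) := by
      rw [hw]; push_cast
      field_simp
    rw [this, Complex.exp_int_mul_two_pi_mul_I]
  rw [h2, sub_self, zero_mul]

/-- **A non-negative Dirichlet series with abscissa of convergence `1` vanishing on the whole vertical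
arithmetic progression `1/2 + ikπ/log 2`, `k ∈ ℤ`.** There are `a : ℕ → ℝ` with `a ≥ 0`, `a 1 = 1`
(namely `a (m²) = m` for odd `m`, `a n = 0` otherwise) and `G : ℂ → ℂ` (namely
`G(s) = L(2s-1, χ₀ mod 2) = (1 - 2^{1-2s}) ζ(2s-1)`) such that `∑ a_n n^{-s}` converges to `G(s)` for
`Re s > 1`, `G` is holomorphic off `1` and meromorphic at `1`, `‖G(s)‖ ≤ 375 (1+|Im s|)³` on
`0 ≤ Re s ≤ 2`, `|s-1| ≥ 1`, and `G(1/2 + ikπ/log 2) = 0` for every `k ∈ ℤ`. This refutes every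
"no vertical arithmetic progression of zeros from positivity + finitely many poles + polynomial growth"
statement at `D = 1/2` (cf. the module docstring and [LapidusVanfrankenhuijsen2006, Thm 11.12], which is
false as printed). [folklore] -/
theorem exists_nonneg_LSeries_vanishing_on_vertical_AP_half :
    ∃ (a : ℕ → ℝ) (G : ℂ → ℂ), (∀ m, 0 ≤ a m) ∧ a 1 = 1 ∧
      (∀ s : ℂ, 1 < s.re →
        LSeriesSummable (fun m => (a m : ℂ)) s ∧ G s = LSeries (fun m => (a m : ℂ)) s) ∧
      DifferentiableOn ℂ G ({1}ᶜ : Set ℂ) ∧ MeromorphicAt G 1 ∧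
      (∀ s : ℂ, 0 ≤ s.re → s.re ≤ 2 → 1 ≤ ‖s - 1‖ → ‖G s‖ ≤ 375 * (1 + |s.im|) ^ (3 : ℝ)) ∧
      ∀ k : ℤ, G (((1 / 2 : ℝ) : ℂ) + (k : ℂ) * ((Real.pi / Real.log 2 : ℝ) : ℂ) * I) = 0 := by
  set χ : ℕ → ℂ := fun m => (1 : DirichletCharacter ℂ 2) (m : ZMod 2) with hχ
  set a : ℕ → ℝ := fun n => if Odd n ∧ Nat.sqrt n * Nat.sqrt n = n then (Nat.sqrt n : ℝ) else 0
    with ha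
  set G : ℂ → ℂ := fun s => DirichletCharacter.LFunctionTrivChar 2 (2 * s - 1) with hG
  have hsq_inj : Function.Injective (fun m : ℕ => m * m) := fun m n h => Nat.mul_self_inj.mp h
  -- the terms of `∑ a_n n^{-s}` along the squares are the terms of `L(2s-1, χ₀ mod 2)`
  have hterm : ∀ (s : ℂ) (m : ℕ),
      LSeries.term (fun n => (a n : ℂ)) s (m * m) = LSeries.term χ (2 * s - 1) m := by
    intro s m
    rcases eq_or_ne m 0 with rfl | hm
    · simp
    have hmm : m * m ≠ 0 := Nat.mul_ne_zero hm hm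
    have hmC : (m : ℂ) ≠ 0 := by exact_mod_cast hm
    have ham : a (m * m) = if Odd m then (m : ℝ) else 0 := by
      simp only [ha, Nat.sqrt_eq, Nat.odd_mul, and_self, and_true]
    rw [LSeries.term_of_ne_zero hmm, LSeries.term_of_ne_zero hm, ham]
    simp only [hχ]
    rw [trivCharTwo_natCast]
    by_cases hodd : Odd m
    · simp only [if_pos hodd]
      have hpow : (m : ℂ) ^ s ≠ 0 := by
        rw [Complex.cpow_def_of_ne_zero hmC]; exact Complex.exp_ne_zero _
      rw [Nat.cast_mul, Complex.natCast_mul_natCast_cpow, Complex.cpow_sub _ _ hmC, Complex.cpow_one,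
        two_mul, Complex.cpow_add _ _ hmC]
      push_cast
      field_simp
    · simp only [if_neg hodd]
      push_cast
      simp
  have hsupp : ∀ (s : ℂ) (n : ℕ), n ∉ Set.range (fun m : ℕ => m * m) →
      LSeries.term (fun n => (a n : ℂ)) s n = 0 := by
    intro s n hn
    rw [LSeries.term_def]
    split_ifs with h0
    · rfl
    · have : a n = 0 := by
        simp only [ha]
        rw [if_neg]
        rintro ⟨-, hsq⟩
        exact hn ⟨Nat.sqrt n, hsq⟩
      rw [this]; simp
  refine ⟨a, G, ?_, ?_, ?_, ?_, ?_, ?_, ?_⟩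
  · intro m; simp only [ha]; split_ifs <;> positivity
  · simp [ha]
  · -- Dirichlet series on `Re s > 1`
    intro s hs
    have hs' : 1 < (2 * s - 1).re := by simp; linarith
    have hsum : LSeriesSummable χ (2 * s - 1) := DirichletCharacter.LSeriesSummable_of_one_lt_re _ hs'
    have hcomp : (LSeries.term (fun n => (a n : ℂ)) s) ∘ (fun m : ℕ => m * m)
        = LSeries.term χ (2 * s - 1) := by
      funext m; exact hterm s m
    constructor
    · have := (hsq_inj.summable_iff (f := LSeries.term (fun n => (a n : ℂ)) s) (hsupp s)).mp
      rw [hcomp] at this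
      exact this hsum
    · rw [LSeries, ← hsq_inj.tsum_eq (fun n hn => by_contra fun h => hn (hsupp s n h))]
      simp only [hterm]
      rw [hG]
      exact DirichletCharacter.LFunction_eq_LSeries _ hs'
  · -- holomorphy off `s = 1`
    intro s hs
    rw [Set.mem_compl_iff, Set.mem_singleton_iff] at hs
    have hs1 : 2 * s - 1 ≠ 1 := by
      intro h; apply hs
      linear_combination (1 / 2 : ℂ) * h
    refine (DifferentiableAt.comp s (DirichletCharacter.differentiableAt_LFunction _ _ (Or.inl hs1))
      ?_).differentiableWithinAt
    fun_prop
  · -- meromorphy at `s = 1`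
    have hmer1 : MeromorphicAt (DirichletCharacter.LFunctionTrivChar 2) ((fun s : ℂ => 2 * s - 1) 1) := by
      have h11 : ((fun s : ℂ => 2 * s - 1) 1) = 1 := by norm_num
      rw [h11]
      have hmer : MeromorphicAt
          (fun w : ℂ => (1 - (2 : ℂ) ^ (-w)) * ((w - 1)⁻¹ * riemannZeta₁ w)) 1 := by
        refine MeromorphicAt.mul ?_ (MeromorphicAt.mul ?_ ?_)
        · refine (Differentiable.analyticAt ?_ 1).meromorphicAt
          intro z
          exact (differentiableAt_const _).sub
            ((differentiableAt_id.neg).const_cpow (Or.inl two_ne_zero))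
        · exact ((analyticAt_id.sub analyticAt_const).meromorphicAt).inv
        · exact (differentiable_riemannZeta₁.analyticAt 1).meromorphicAt
      refine hmer.congr ?_
      filter_upwards [self_mem_nhdsWithin] with w hw
      rw [Set.mem_compl_iff, Set.mem_singleton_iff] at hw
      rw [lfunctionTrivCharTwo_eq hw, riemannZeta_eq_inv_sub_mul hw]
    have hg : AnalyticAt ℂ (fun s : ℂ => 2 * s - 1) 1 :=
      ((analyticAt_const.mul analyticAt_id).sub analyticAt_const)
    show MeromorphicAt ((DirichletCharacter.LFunctionTrivChar 2) ∘ (fun s : ℂ => 2 * s - 1)) 1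
    exact MeromorphicAt.comp_analyticAt (g := fun s : ℂ => 2 * s - 1) hmer1 hg
  · -- growth on `0 ≤ Re s ≤ 2`, `|s - 1| ≥ 1`
    intro s hs0 hs2 hs1
    set w : ℂ := 2 * s - 1 with hw
    have hw1 : w ≠ 1 := by
      intro h
      have : s = 1 := by linear_combination (1 / 2 : ℂ) * h
      rw [this, sub_self, norm_zero] at hs1; norm_num at hs1
    have hwre : w.re = 2 * s.re - 1 := by simp [hw]
    have hwim : w.im = 2 * s.im := by simp [hw]
    have hw1' : 1 ≤ ‖w - 1‖ := by
      have : w - 1 = 2 * (s - 1) := by rw [hw]; ring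
      rw [this, norm_mul, Complex.norm_ofNat]; linarith
    have hz := norm_riemannZeta_le_cube_of_re_mem_Icc (w := w) (by rw [hwre]; linarith)
      (by rw [hwre]; linarith) hw1'
    have hfac : ‖1 - (2 : ℂ) ^ (-w)‖ ≤ 3 := by
      refine (norm_sub_le _ _).trans ?_
      rw [norm_one, show (2 : ℂ) = ((2 : ℝ) : ℂ) by norm_num,
        Complex.norm_cpow_eq_rpow_re_of_pos two_pos, neg_re]
      have : (2 : ℝ) ^ (-w.re) ≤ (2 : ℝ) ^ (1 : ℝ) :=
        Real.rpow_le_rpow_of_exponent_le one_le_two (by rw [hwre]; linarith)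
      rw [Real.rpow_one] at this
      linarith
    have hG' : G s = (1 - (2 : ℂ) ^ (-w)) * riemannZeta w := by
      simp only [hG]; rw [← hw]; exact lfunctionTrivCharTwo_eq hw1
    rw [hG', norm_mul, show ((1 + |s.im|) ^ (3 : ℝ) : ℝ) = (1 + |s.im|) ^ (3 : ℕ) by
      exact_mod_cast Real.rpow_natCast (1 + |s.im|) 3]
    rw [hwim] at hz
    have h0 : 0 ≤ |s.im| := abs_nonneg _
    have habs : |2 * s.im| = 2 * |s.im| := by rw [abs_mul, abs_two]
    rw [habs] at hz
    have hz' : ‖riemannZeta w‖ ≤ 125 * (1 + |s.im|) ^ 3 := by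
      refine hz.trans ?_
      nlinarith [pow_le_pow_left₀ (by positivity : (0 : ℝ) ≤ 2 * |s.im| + 5)
        (by linarith : 2 * |s.im| + 5 ≤ 5 * (1 + |s.im|)) 3]
    have h1 : 0 ≤ (1 + |s.im|) ^ 3 := by positivity
    calc ‖1 - (2 : ℂ) ^ (-w)‖ * ‖riemannZeta w‖ ≤ 3 * (125 * (1 + |s.im|) ^ 3) :=
          mul_le_mul hfac hz' (norm_nonneg _) (by norm_num)
      _ = 375 * (1 + |s.im|) ^ 3 := by ring
  · -- zeros on the whole progression `1/2 + ikπ/log 2`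
    intro k
    simp only [hG]
    have : 2 * ((((1 / 2 : ℝ) : ℂ)) + (k : ℂ) * ((Real.pi / Real.log 2 : ℝ) : ℂ) * I) - 1
        = (k : ℂ) * ((2 * Real.pi / Real.log 2 : ℝ) : ℂ) * I := by
      push_cast; ring
    rw [this]
    exact lfunctionTrivCharTwo_vanish k

end Literature.NumberTheory.LFunctions

end
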